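import Mathlib
import HarnessLib
import Summits.Ventures.LatticeQCDFlow.Scoring.ChainBurnIn

/-!
# The path law of the simulated chain is determined by its initial law and its one-step tower
# identities — and therefore maps functorially: lumped chains and shifted chains are chains

HONEST FRAMING: exact (Metropolis-corrected) sampling algorithms for lattice gauge theory;
figures of merit are autocorrelation/cost numbers at stated couplings and volumes; no
continuum-physics claim.

Venture `LatticeQCDFlow` (cell pub-lqcd), topic `Scoring`; FANOUT row 8 (`s0-cpn-nemc`, GEN-15).
NEW WORK of the cell, not a published result; no definition is introduced.  Every chain-level
theorem of the row (`Scoring/ChainTimeAverage.lean`, `Scoring/ChainBurnIn.lean`,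
`Scoring/ChainMeanSquareError.lean`, …) speaks about ONE measure: Mathlib's Ionescu-Tulcea law
`P_{μ₀,κ} := Kernel.trajMeasure μ₀ (n ↦ κ ∘ (h ↦ h n))` of the homogeneous Markov chain with kernel
`κ` started in `μ₀`.  Derived samplers — the sampler that records every `k`-th state
(`Scoring/DoeblinThinning.lean`), the stream observed after a burn-in of `s` updates
(`Scoring/ChainBurnInDiscard.lean`, `Scoring/ReplicaChainsBurnIn.lean`), a coordinate of an
augmented chain — were so far MODELLED as chains with the derived kernel.  This file supplies the
missing identification principle, so that such statements become theorems about images of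
`P_{μ₀,κ}` itself.  Printed counterpart NAMED ONLY: uniqueness in the Ionescu-Tulcea theorem /
the Markov property of the canonical chain (Kallenberg 2021, *Foundations of Modern Probability*,
3rd ed., Thm 8.24 and Ch. 11; Meyn–Tweedie 1993 §3.4), and Dynkin's criterion for a function of
a Markov chain to be Markov (Kemeny–Snell 1960, *Finite Markov Chains*, §6.3 "lumpability";
Rogers–Pitman 1981, *Markov functions*, Ann. Probab. 9) — nothing is cited as a fact; the proofs
are from Mathlib's projective-limit uniqueness (`IsProjectiveLimit.unique`) and the row's tower
property `chain_tower`.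

## Content (`κ` Markov on `Ω`; `P_{μ₀,κ}` as above; observables bounded measurable)

* `measure_eq_of_map_frestrictLe_eq` — two finite measures on `ℕ → Ω` with the same images under
  every `frestrictLe n` are equal; `map_frestrictLe_zero_eq`, `map_frestrictLe_succ_eq`,
  `measurable_appendIic`, `measureReal_map_pair_prod`, `integral_frestrictLe_mul` — bookkeeping (the history up to `n + 1` is the pair (history up to
  `n`, point at `n + 1`); rectangles as integrals of indicator products);
* `chain_map_eval_zero` — the time-`0` marginal of `P_{μ₀,κ}` is `μ₀` (measure form of
  `chain_initial`);
* **`chain_tower_iterate`** — the `t`-STEP tower property with an arbitrary bounded measurable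
  functional of the history: `E[F(X_{≤s}) g(X_{s+t})] = E[F(X_{≤s}) ((kop κ)^[t] g)(X_s)]`
  (`chain_twoTime` is the case `F = f(X_s)`);
* **`eq_chain_of_tower`** — UNIQUENESS: a probability measure `Q` on `ℕ → Ω` whose time-`0`
  marginal is `μ₀` and which satisfies the one-step tower identities
  `∫ F(x_{≤a}) g(x_{a+1}) dQ = ∫ F(x_{≤a}) (kop κ g)(x_a) dQ` for all `a` and all bounded measurable
  `F`, `g` IS `P_{μ₀,κ}` (induction on the `frestrictLe n`-marginals over the rectangle π-system,
  then projective-limit uniqueness);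
* **`chain_map_of_intertwining`** — FUNCTORIALITY (Dynkin's criterion): if `φ : Ω' → Ω` is
  measurable and `(κ' x').map φ = κ (φ x')` for all `x'`, then the image of `P_{μ₀',κ'}` under
  `x' ↦ φ ∘ x'` is `P_{μ₀'.map φ, κ}` — a coordinate / statistic of a chain that is itself driven by a
  kernel is the chain of that kernel, as a LAW ON PATH SPACE;
* **`chain_map_shift`** — the MARKOV PROPERTY AT PATH LEVEL: the image of `P_{μ₀,κ}` under the shift
  `x ↦ (n ↦ x (s + n))` is `P_{μ_s,κ}` with `μ_s` the time-`s` marginal — the stream a seat records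
  after discarding `s` updates is the `κ`-chain started from `μ_s` (what `Scoring/ChainBurnInDiscard`
  and `Scoring/WarmStartTransfer` used at the level of second moments only).

Reading (value-free): with these three theorems every any-start certificate of the row transfers
verbatim to lumped, shifted and (next file, `Scoring/ThinnedPathLaw.lean`) thinned streams of the
chain a seat actually simulates; no modelling step remains between "the sampler records every
`k`-th state after `s` burn-in updates" and the kernel-level bounds.  NOT CLAIMED: anything about a
concrete sampler; the strong Markov property / regeneration times (not needed here, not proved).
-/

noncomputable section

namespace Summit.Ventures.LatticeQCDFlow.Scoring

open MeasureTheory ProbabilityTheory Filter Finset Preorder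
open scoped ENNReal

variable {Ω : Type*} [MeasurableSpace Ω]

/-! ### Laws on path space: finite-dimensional marginals and the successor step -/

section PathSpace

/-- Two finite measures on `ℕ → Ω` with the same image under every `frestrictLe n` are equal
(both are projective limits of one projective family; Mathlib's `IsProjectiveLimit.unique`). -/
theorem measure_eq_of_map_frestrictLe_eq {P Q : Measure (ℕ → Ω)} [IsFiniteMeasure P]
    [IsFiniteMeasure Q] (h : ∀ n : ℕ, P.map (frestrictLe n) = Q.map (frestrictLe n)) : P = Q := by
  have hfam : IsProjectiveMeasureFamily (α := fun _ : ℕ => Ω)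
      (fun J : Finset ℕ => Q.map (J.restrict (π := fun _ : ℕ => Ω))) := by
    intro I J hJI
    simp only
    rw [Measure.map_map (Finset.measurable_restrict₂ hJI) (Finset.measurable_restrict I)]
    rfl
  have hQ : IsProjectiveLimit (α := fun _ : ℕ => Ω) Q
      (fun J : Finset ℕ => Q.map (J.restrict (π := fun _ : ℕ => Ω))) := fun _ => rfl
  have hP : IsProjectiveLimit (α := fun _ : ℕ => Ω) P
      (fun J : Finset ℕ => Q.map (J.restrict (π := fun _ : ℕ => Ω))) := by
    rw [isProjectiveLimit_nat_iff hfam _]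
    intro n
    exact h n
  exact hP.unique hQ

/-- The image under `frestrictLe 0` is the image under the time-`0` coordinate, re-indexed by
`MeasurableEquiv.piUnique`. -/
theorem map_frestrictLe_zero_eq (ν : Measure (ℕ → Ω)) :
    ν.map (frestrictLe 0) = (ν.map (fun x : ℕ → Ω => x 0)).map
      (MeasurableEquiv.piUnique (fun _ : ↥(Finset.Iic 0) => Ω)).symm := by
  have hcomp : (frestrictLe (π := fun _ : ℕ => Ω) 0)
      = (MeasurableEquiv.piUnique (fun _ : ↥(Finset.Iic 0) => Ω)).symm ∘ (fun x : ℕ → Ω => x 0) := by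
    funext x i
    have hi : (i : ℕ) = 0 := Nat.le_zero.1 (Finset.mem_Iic.1 i.2)
    show x (i : ℕ) = _
    rw [hi]
    rfl
  rw [hcomp]
  exact (Measure.map_map (MeasurableEquiv.measurable _) (measurable_pi_apply 0)).symm

/-- Appending the point at time `n + 1` to a history up to time `n` is measurable. -/
theorem measurable_appendIic (n : ℕ) :
    Measurable (fun p : ((i : ↥(Finset.Iic n)) → Ω) × Ω => fun i : ↥(Finset.Iic (n + 1)) =>
      if h : (i : ℕ) ≤ n then p.1 ⟨i, Finset.mem_Iic.2 h⟩ else p.2) := by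
  refine measurable_pi_lambda _ fun i => ?_
  by_cases hi : (i : ℕ) ≤ n
  · simp only [hi, dif_pos]
    exact (measurable_pi_apply _).comp measurable_fst
  · simp only [hi, dif_neg, not_false_eq_true]
    exact measurable_snd

/-- The history up to time `n + 1` is the pair (history up to `n`, point at `n + 1`), appended:
`R.map (frestrictLe (n+1))` is the image of `R.map (x ↦ (x_{≤n}, x_{n+1}))`. -/
theorem map_frestrictLe_succ_eq (ν : Measure (ℕ → Ω)) (n : ℕ) :
    ν.map (frestrictLe (n + 1)) = (ν.map (fun x : ℕ → Ω => (frestrictLe n x, x (n + 1)))).map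
      (fun p : ((i : ↥(Finset.Iic n)) → Ω) × Ω => fun i : ↥(Finset.Iic (n + 1)) =>
        if h : (i : ℕ) ≤ n then p.1 ⟨i, Finset.mem_Iic.2 h⟩ else p.2) := by
  rw [Measure.map_map (measurable_appendIic n)
    ((measurable_frestrictLe n).prodMk (measurable_pi_apply _))]
  congr 1
  funext x i
  show x (i : ℕ) = _
  simp only [Function.comp_apply]
  by_cases hi : (i : ℕ) ≤ n
  · rw [dif_pos hi]; rfl
  · rw [dif_neg hi]
    have hi' : (i : ℕ) = n + 1 :=
      le_antisymm (Finset.mem_Iic.1 i.2) (Nat.succ_le_of_lt (Nat.lt_of_not_le hi))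
    rw [hi']

/-- A rectangle of the joint law of (history up to `n`, point at `n + 1`) is the integral of a
product of indicators. -/
theorem measureReal_map_pair_prod (ν : Measure (ℕ → Ω)) (n : ℕ)
    {S : Set ((i : ↥(Finset.Iic n)) → Ω)} (hS : MeasurableSet S) {B : Set Ω}
    (hB : MeasurableSet B) :
    (ν.map (fun x : ℕ → Ω => (frestrictLe n x, x (n + 1)))).real (S ×ˢ B)
      = ∫ x, S.indicator (1 : ((i : ↥(Finset.Iic n)) → Ω) → ℝ) (frestrictLe n x)
          * B.indicator (1 : Ω → ℝ) (x (n + 1)) ∂ν := by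
  have hpair : Measurable fun x : ℕ → Ω => (frestrictLe n x, x (n + 1)) :=
    (measurable_frestrictLe n).prodMk (measurable_pi_apply _)
  rw [map_measureReal_apply hpair (hS.prod hB), ← integral_indicator_one (hpair (hS.prod hB))]
  refine integral_congr_ae (ae_of_all _ fun x => ?_)
  by_cases h1 : frestrictLe n x ∈ S <;> by_cases h2 : x (n + 1) ∈ B <;>
    simp [Set.indicator, h1, h2, Set.mem_prod, Set.mem_preimage]

/-- Integrals of functionals of (history up to `n`, point at `n`) against the `frestrictLe n`
marginal. -/
theorem integral_frestrictLe_mul (ν : Measure (ℕ → Ω)) (n : ℕ)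
    {F : ((i : ↥(Finset.Iic n)) → Ω) → ℝ} (hF : Measurable F) {G : Ω → ℝ} (hG : Measurable G) :
    ∫ x, F (frestrictLe n x) * G (x n) ∂ν
      = ∫ h, F h * G (h ⟨n, Finset.mem_Iic.2 le_rfl⟩) ∂(ν.map (frestrictLe n)) := by
  rw [integral_map (measurable_frestrictLe n).aemeasurable]
  · rfl
  · exact (hF.mul (hG.comp (measurable_pi_apply _))).aestronglyMeasurable

end PathSpace

/-! ### The chain: time-`0` marginal, iterated tower property, uniqueness, functoriality -/

section Chain

variable (κ : Kernel Ω Ω) [IsMarkovKernel κ] (μ₀ : Measure Ω) [IsProbabilityMeasure μ₀]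

/-- **The time-`0` marginal of the chain is the initial law** (measure form of `chain_initial`). -/
theorem chain_map_eval_zero :
    (Kernel.trajMeasure (X := fun _ : ℕ => Ω) μ₀
        (fun n : ℕ => κ.comap (fun h : (i : ↥(Finset.Iic n)) → Ω => h ⟨n, Finset.mem_Iic.2 le_rfl⟩)
          (measurable_pi_apply _))).map (fun x : ℕ → Ω => x 0) = μ₀ := by
  ext B hB
  rw [← measureReal_eq_measureReal_iff (measure_ne_top _ _) (measure_ne_top _ _),
    map_measureReal_apply (measurable_pi_apply 0) hB,
    ← integral_indicator_one ((measurable_pi_apply 0) hB), ← integral_indicator_one hB]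
  exact chain_initial κ μ₀ (f := B.indicator 1) (measurable_one.indicator hB)

/-- **The `t`-step tower property with a history functional**: for bounded measurable `F` of the
history up to time `s` and bounded measurable `g`,
`E[F(X_{≤s}) g(X_{s+t})] = E[F(X_{≤s}) ((kop κ)^[t] g)(X_s)]`. -/
theorem chain_tower_iterate (s : ℕ) {F : ((i : ↥(Finset.Iic s)) → Ω) → ℝ} (hF : Measurable F)
    {CF : ℝ} (hCF : ∀ h, |F h| ≤ CF) :
    ∀ (t : ℕ) {g : Ω → ℝ}, Measurable g → ∀ {Cg : ℝ}, (∀ x, |g x| ≤ Cg) →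
    ∫ x, F (frestrictLe s x) * g (x (s + t)) ∂(Kernel.trajMeasure (X := fun _ : ℕ => Ω) μ₀
        (fun n : ℕ => κ.comap (fun h : (i : ↥(Finset.Iic n)) → Ω => h ⟨n, Finset.mem_Iic.2 le_rfl⟩)
          (measurable_pi_apply _)))
      = ∫ x, F (frestrictLe s x) * (kop κ)^[t] g (x s) ∂(Kernel.trajMeasure (X := fun _ : ℕ => Ω) μ₀
        (fun n : ℕ => κ.comap (fun h : (i : ↥(Finset.Iic n)) → Ω => h ⟨n, Finset.mem_Iic.2 le_rfl⟩)
          (measurable_pi_apply _)))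
  | 0, g, _, _, _ => by simp only [Nat.add_zero, Function.iterate_zero, id]
  | t + 1, g, hg, Cg, hCg => by
    have key := chain_tower κ μ₀ (s + t)
      (F := fun h : (i : ↥(Finset.Iic (s + t))) → Ω =>
        F (fun i : ↥(Finset.Iic s) =>
          h ⟨i, Finset.mem_Iic.2 ((Finset.mem_Iic.1 i.2).trans (Nat.le_add_right s t))⟩))
      (hF.comp (measurable_pi_lambda _ fun i => measurable_pi_apply _)) (fun h => hCF _) hg hCg
    have key' : ∫ x, F (frestrictLe s x) * g (x (s + t + 1))
          ∂(Kernel.trajMeasure (X := fun _ : ℕ => Ω) μ₀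
            (fun n : ℕ => κ.comap (fun h : (i : ↥(Finset.Iic n)) → Ω =>
              h ⟨n, Finset.mem_Iic.2 le_rfl⟩) (measurable_pi_apply _)))
        = ∫ x, F (frestrictLe s x) * kop κ g (x (s + t))
          ∂(Kernel.trajMeasure (X := fun _ : ℕ => Ω) μ₀
            (fun n : ℕ => κ.comap (fun h : (i : ↥(Finset.Iic n)) → Ω =>
              h ⟨n, Finset.mem_Iic.2 le_rfl⟩) (measurable_pi_apply _))) := key
    rw [show s + (t + 1) = s + t + 1 from rfl, key',
      chain_tower_iterate s hF hCF t (measurable_kop κ hg) (abs_kop_le κ hCg),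
      Function.iterate_succ_apply]

/-- **UNIQUENESS OF THE CHAIN LAW.**  A probability measure `Q` on `ℕ → Ω` whose time-`0` marginal
is `μ₀` and which satisfies the one-step tower identities of the kernel `κ` —
`∫ F(x_{≤a}) g(x_{a+1}) dQ = ∫ F(x_{≤a}) (kop κ g)(x_a) dQ` for every `a` and all bounded measurable
`F`, `g` — is the Ionescu-Tulcea law of the chain with kernel `κ` started in `μ₀`. -/
theorem eq_chain_of_tower (Q : Measure (ℕ → Ω)) [IsProbabilityMeasure Q]
    (h0 : Q.map (fun x : ℕ → Ω => x 0) = μ₀)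
    (hstep : ∀ (a : ℕ) {F : ((i : ↥(Finset.Iic a)) → Ω) → ℝ}, Measurable F → ∀ {CF : ℝ},
      (∀ h, |F h| ≤ CF) → ∀ {g : Ω → ℝ}, Measurable g → ∀ {Cg : ℝ}, (∀ x, |g x| ≤ Cg) →
      ∫ x, F (frestrictLe a x) * g (x (a + 1)) ∂Q = ∫ x, F (frestrictLe a x) * kop κ g (x a) ∂Q) :
    Q = Kernel.trajMeasure (X := fun _ : ℕ => Ω) μ₀
        (fun n : ℕ => κ.comap (fun h : (i : ↥(Finset.Iic n)) → Ω => h ⟨n, Finset.mem_Iic.2 le_rfl⟩)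
          (measurable_pi_apply _)) := by
  refine measure_eq_of_map_frestrictLe_eq fun n => ?_
  induction n with
  | zero =>
    rw [map_frestrictLe_zero_eq Q, map_frestrictLe_zero_eq, h0, chain_map_eval_zero]
  | succ n ih =>
    have hpair : Measurable fun x : ℕ → Ω => (frestrictLe n x, x (n + 1)) :=
      (measurable_frestrictLe n).prodMk (measurable_pi_apply _)
    rw [map_frestrictLe_succ_eq Q n, map_frestrictLe_succ_eq _ n]
    congr 1
    refine ext_of_generate_finite _ generateFrom_prod.symm isPiSystem_prod (fun s hs => ?_) ?_
    · obtain ⟨S, hS, B, hB, rfl⟩ := hs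
      replace hS : MeasurableSet S := hS
      replace hB : MeasurableSet B := hB
      have hSm : Measurable (S.indicator (1 : ((i : ↥(Finset.Iic n)) → Ω) → ℝ)) :=
        measurable_one.indicator hS
      have hBm : Measurable (B.indicator (1 : Ω → ℝ)) := measurable_one.indicator hB
      have hS1 : ∀ h, |S.indicator (1 : ((i : ↥(Finset.Iic n)) → Ω) → ℝ) h| ≤ 1 := fun h => by
        by_cases hh : h ∈ S <;> simp [hh]
      have hB1 : ∀ y, |B.indicator (1 : Ω → ℝ) y| ≤ 1 := fun y => by
        by_cases hy : y ∈ B <;> simp [hy]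
      rw [← measureReal_eq_measureReal_iff (measure_ne_top _ _) (measure_ne_top _ _),
        measureReal_map_pair_prod Q n hS hB, measureReal_map_pair_prod _ n hS hB,
        hstep n hSm hS1 hBm hB1, chain_tower κ μ₀ n hSm hS1 hBm hB1,
        integral_frestrictLe_mul Q n hSm (measurable_kop κ hBm),
        integral_frestrictLe_mul _ n hSm (measurable_kop κ hBm), ih]
    · rw [Measure.map_apply hpair MeasurableSet.univ, Measure.map_apply hpair MeasurableSet.univ,
        Set.preimage_univ, measure_univ, measure_univ]

/-- **FUNCTORIALITY (Dynkin's criterion, path-space form).**  If `φ : Ω' → Ω` is measurable and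
intertwines the kernels, `(κ' x').map φ = κ (φ x')` for every `x'`, then the image of the chain law
`P_{μ₀',κ'}` under `x' ↦ φ ∘ x'` is the chain law `P_{μ₀'.map φ, κ}`. -/
theorem chain_map_of_intertwining {Ω' : Type*} [MeasurableSpace Ω'] (κ' : Kernel Ω' Ω')
    [IsMarkovKernel κ'] (μ₀' : Measure Ω') [IsProbabilityMeasure μ₀'] {φ : Ω' → Ω}
    (hφ : Measurable φ) (hint : ∀ x', (κ' x').map φ = κ (φ x')) :
    (Kernel.trajMeasure (X := fun _ : ℕ => Ω') μ₀'
        (fun n : ℕ => κ'.comap (fun h : (i : ↥(Finset.Iic n)) → Ω' => h ⟨n, Finset.mem_Iic.2 le_rfl⟩)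
          (measurable_pi_apply _))).map (fun (x' : ℕ → Ω') (n : ℕ) => φ (x' n))
      = Kernel.trajMeasure (X := fun _ : ℕ => Ω) (μ₀'.map φ)
        (fun n : ℕ => κ.comap (fun h : (i : ↥(Finset.Iic n)) → Ω => h ⟨n, Finset.mem_Iic.2 le_rfl⟩)
          (measurable_pi_apply _)) := by
  haveI : IsProbabilityMeasure (μ₀'.map φ) := Measure.isProbabilityMeasure_map hφ.aemeasurable
  have hΦ : Measurable (fun (x' : ℕ → Ω') (n : ℕ) => φ (x' n)) :=
    measurable_pi_lambda _ fun n => hφ.comp (measurable_pi_apply n)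
  haveI : IsProbabilityMeasure ((Kernel.trajMeasure (X := fun _ : ℕ => Ω') μ₀'
      (fun n : ℕ => κ'.comap (fun h : (i : ↥(Finset.Iic n)) → Ω' => h ⟨n, Finset.mem_Iic.2 le_rfl⟩)
        (measurable_pi_apply _))).map (fun (x' : ℕ → Ω') (n : ℕ) => φ (x' n))) :=
    Measure.isProbabilityMeasure_map hΦ.aemeasurable
  have hkop : ∀ {g : Ω → ℝ}, Measurable g → ∀ z, kop κ' (g ∘ φ) z = kop κ g (φ z) := by
    intro g hg z
    show ∫ y, (g ∘ φ) y ∂(κ' z) = ∫ y, g y ∂(κ (φ z))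
    rw [← hint z, integral_map hφ.aemeasurable hg.aestronglyMeasurable]
    rfl
  refine eq_chain_of_tower κ (μ₀'.map φ) _ ?_ ?_
  · rw [Measure.map_map (measurable_pi_apply 0) hΦ]
    have : (fun x : ℕ → Ω => x 0) ∘ (fun (x' : ℕ → Ω') (n : ℕ) => φ (x' n))
        = φ ∘ (fun x' : ℕ → Ω' => x' 0) := rfl
    rw [this, ← Measure.map_map hφ (measurable_pi_apply 0), chain_map_eval_zero]
  · intro a F hF CF hCF g hg Cg hCg
    have hm1 : Measurable fun x : ℕ → Ω => F (frestrictLe a x) * g (x (a + 1)) :=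
      (hF.comp (measurable_frestrictLe a)).mul (hg.comp (measurable_pi_apply _))
    have hm2 : Measurable fun x : ℕ → Ω => F (frestrictLe a x) * kop κ g (x a) :=
      (hF.comp (measurable_frestrictLe a)).mul ((measurable_kop κ hg).comp (measurable_pi_apply _))
    rw [integral_map hΦ.aemeasurable hm1.aestronglyMeasurable,
      integral_map hΦ.aemeasurable hm2.aestronglyMeasurable]
    have hF' : Measurable fun h' : (i : ↥(Finset.Iic a)) → Ω' =>
        F (fun i : ↥(Finset.Iic a) => φ (h' i)) :=
      hF.comp (measurable_pi_lambda _ fun i => hφ.comp (measurable_pi_apply i))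
    have key := chain_tower κ' μ₀' a
      (F := fun h' : (i : ↥(Finset.Iic a)) → Ω' => F (fun i : ↥(Finset.Iic a) => φ (h' i)))
      hF' (fun h' => hCF _) (hg.comp hφ) (Cg := Cg) (fun x => hCg (φ x))
    simp only [Function.comp_apply, hkop hg] at key
    exact key

/-- **THE MARKOV PROPERTY AT PATH LEVEL (restart / burn-in).**  The image of the chain law
`P_{μ₀,κ}` under the time shift `x ↦ (n ↦ x (s + n))` is the chain law `P_{μ_s,κ}` started from the
time-`s` marginal `μ_s := P_{μ₀,κ}.map (x ↦ x s)`: the stream recorded after discarding `s` updates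
IS the `κ`-chain from `μ_s`. -/
theorem chain_map_shift (s : ℕ) :
    (Kernel.trajMeasure (X := fun _ : ℕ => Ω) μ₀
        (fun n : ℕ => κ.comap (fun h : (i : ↥(Finset.Iic n)) → Ω => h ⟨n, Finset.mem_Iic.2 le_rfl⟩)
          (measurable_pi_apply _))).map (fun (x : ℕ → Ω) (n : ℕ) => x (s + n))
      = Kernel.trajMeasure (X := fun _ : ℕ => Ω)
        ((Kernel.trajMeasure (X := fun _ : ℕ => Ω) μ₀
          (fun n : ℕ => κ.comap (fun h : (i : ↥(Finset.Iic n)) → Ω => h ⟨n, Finset.mem_Iic.2 le_rfl⟩)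
            (measurable_pi_apply _))).map (fun x : ℕ → Ω => x s))
        (fun n : ℕ => κ.comap (fun h : (i : ↥(Finset.Iic n)) → Ω => h ⟨n, Finset.mem_Iic.2 le_rfl⟩)
          (measurable_pi_apply _)) := by
  have hΘ : Measurable (fun (x : ℕ → Ω) (n : ℕ) => x (s + n)) :=
    measurable_pi_lambda _ fun n => measurable_pi_apply _
  haveI : IsProbabilityMeasure ((Kernel.trajMeasure (X := fun _ : ℕ => Ω) μ₀
      (fun n : ℕ => κ.comap (fun h : (i : ↥(Finset.Iic n)) → Ω => h ⟨n, Finset.mem_Iic.2 le_rfl⟩)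
        (measurable_pi_apply _))).map (fun x : ℕ → Ω => x s)) :=
    Measure.isProbabilityMeasure_map (measurable_pi_apply s).aemeasurable
  haveI : IsProbabilityMeasure ((Kernel.trajMeasure (X := fun _ : ℕ => Ω) μ₀
      (fun n : ℕ => κ.comap (fun h : (i : ↥(Finset.Iic n)) → Ω => h ⟨n, Finset.mem_Iic.2 le_rfl⟩)
        (measurable_pi_apply _))).map (fun (x : ℕ → Ω) (n : ℕ) => x (s + n))) :=
    Measure.isProbabilityMeasure_map hΘ.aemeasurable
  refine eq_chain_of_tower κ _ _ ?_ ?_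
  · rw [Measure.map_map (measurable_pi_apply 0) hΘ]
    rfl
  · intro a F hF CF hCF g hg Cg hCg
    have hm1 : Measurable fun x : ℕ → Ω => F (frestrictLe a x) * g (x (a + 1)) :=
      (hF.comp (measurable_frestrictLe a)).mul (hg.comp (measurable_pi_apply _))
    have hm2 : Measurable fun x : ℕ → Ω => F (frestrictLe a x) * kop κ g (x a) :=
      (hF.comp (measurable_frestrictLe a)).mul ((measurable_kop κ hg).comp (measurable_pi_apply _))
    rw [integral_map hΘ.aemeasurable hm1.aestronglyMeasurable,
      integral_map hΘ.aemeasurable hm2.aestronglyMeasurable]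
    have hF' : Measurable fun h : (i : ↥(Finset.Iic (s + a))) → Ω =>
        F (fun i : ↥(Finset.Iic a) => h ⟨s + i, Finset.mem_Iic.2
          (Nat.add_le_add_left (Finset.mem_Iic.1 i.2) s)⟩) :=
      hF.comp (measurable_pi_lambda _ fun i => measurable_pi_apply _)
    have key := chain_tower κ μ₀ (s + a)
      (F := fun h : (i : ↥(Finset.Iic (s + a))) → Ω =>
        F (fun i : ↥(Finset.Iic a) => h ⟨s + i, Finset.mem_Iic.2
          (Nat.add_le_add_left (Finset.mem_Iic.1 i.2) s)⟩))
      hF' (fun h => hCF _) hg hCg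
    exact key

end Chain

end Summit.Ventures.LatticeQCDFlow.Scoring

end
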